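import Literature.NumberTheory.Irrationality.RhinViola2001.ThetaInvarianceProofs
import Literature.NumberTheory.LFunctions.LcmUptoCubeBound
import HarnessLib

/-!
# Rhin–Viola 2001, Theorem 2.1 — the bookkeeping of the integers (2.8) and of `d_M d_N d_Q`

Topic `Literature/NumberTheory/Irrationality/RhinViola2001`. First of three theorem-only companion files
(`TheoremTwoOneArithmetic` → `TheoremTwoOneAnalysis` → `TheoremTwoOneProofs`) discharging the named fact `theorem21` of
`GroupStructure.lean`: G. Rhin, C. Viola, *The group structure for ζ(3)*, Acta Arith. **97** (2001) 269–293
[RhinViola2001], Theorem 2.1 (pp. 273–274) with its proof (pp. 274–275; held text `paper:doi-10-4064-aa97-3-6`).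
This file holds the parameter side of the printed proof, with no analysis:

* the successive maxima `succMax` of `GroupStructure.lean` through counting (`le_succMax_iff`: `t ≤ max⁽ⁱ⁾ L` iff more than
  `i` entries of `L` are `≥ t`), whence "`M, N` and `Q` are invariant under the actions of `ϑ`" (`denomS_theta_iter`), three
  integers which "occur in distinct places in the list (2.8)" have `d_u d_v d_w ∣ d_M d_N d_Q` (`prod_d_dvd`,
  `d_slots_dvd_denomS`, `d_cube_dvd_denomS_star`), and tuples whose (2.8) are pointwise `≤` have
  `d_{M'} d_{N'} d_{Q'} ∣ d_M d_N d_Q` (`prod_d_succMax_dvd_of_forall₂`; "the integers `M, N` and `Q` associated with any one of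
  the three integrals do not exceed, respectively, the integers `M, N` and `Q` for `I`");
* the powers of `ϑ = (h j k l m q r s)` on the parameters (`theta_iter_*`, `I_theta_iter` from the tree's
  `ThetaInvariance.I_theta`), the choice of the power of `ϑ` in the two places the proof uses one
  (`exists_theta_iter_aux_q_neg`, `terminal`);
* the three tuples of the linear decomposition (2.10) (`decomp_one/two/three`: balanced, non-negative, smaller sum, smaller
  `d_M d_N d_Q`), and the terminal analysis of p. 275 ("First case: `j = q = 0` … Second case: `j = 0, q > 0`"):
  `terminal_of_j_eq_zero`, `terminal` — if no power of `ϑ` makes `lmqr > 0` and all of (2.7)–(2.8) are non-negative, the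
  tuple is a `ϑ`-rotate of `(h,0,h,0,h,0,h,0)`;
* transport of the conclusion (2.9) "`I = a + 2bζ(3)`, `d_M d_N d_Q a ∈ ℤ`, `b ∈ ℤ`" along these steps (`concl_of_eq`,
  `concl_of_decomp`, `concl_of_rat`, `concl_of_star`).

HONEST FRAMING (cell pub-zeta5): systematic search; no irrationality claim unless certified; nothing here concerns `ζ(5)`.
Theorems only; no definition, no named fact.

## References
* [RhinViola2001] G. Rhin, C. Viola, The group structure for ζ(3), Acta Arith. 97 (2001) 269–293, doi:10.4064/aa97-3-6,
  Theorem 2.1 and its proof, pp. 273–275.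
-/

noncomputable section

namespace Literature.NumberTheory.Irrationality.RhinViola2001

namespace TheoremTwoOne

open Literature.NumberTheory.LFunctions (lcmUpto_dvd_lcmUpto_of_le)

/-! ### Successive maxima and counting -/

/-- For a list sorted decreasingly, `t ≤ L[i]` iff more than `i` entries of `L` are `≥ t`. [folklore] -/
private theorem lt_countP_iff_of_sortedGE {L : List ℤ} (hL : L.SortedGE) (t : ℤ) {i : ℕ} (hi : i < L.length) :
    i < L.countP (fun x => decide (t ≤ x)) ↔ t ≤ L[i] := by
  induction L generalizing i with
  | nil => simp at hi
  | cons a L ih =>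
    rw [List.sortedGE_iff_pairwise, List.pairwise_cons] at hL
    have hL' : L.SortedGE := List.sortedGE_iff_pairwise.2 hL.2
    rw [List.countP_cons]
    by_cases hta : t ≤ a
    · simp only [hta, decide_true, ↓reduceIte]
      cases i with
      | zero => simpa using hta
      | succ i =>
        have hi' : i < L.length := by simpa using hi
        rw [List.getElem_cons_succ, ← ih hL' hi']
        omega
    · have hzero : L.countP (fun x => decide (t ≤ x)) = 0 := by
        rw [List.countP_eq_zero]
        intro b hb
        have := hL.1 b hb
        simp only [decide_eq_true_eq, not_le]
        omega
      simp only [hta, decide_false, hzero]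
      constructor
      · intro h; simp at h
      · intro h
        exfalso
        cases i with
        | zero => exact hta (by simpa using h)
        | succ i =>
          have hi' : i < L.length := by simpa using hi
          rw [List.getElem_cons_succ] at h
          have := hL.1 _ (List.getElem_mem hi')
          omega

/-- `t ≤ succMax L i` iff more than `i` entries of `L` are `≥ t` (`i < |L|`). [folklore] -/
private theorem le_succMax_iff {L : List ℤ} (t : ℤ) {i : ℕ} (hi : i < L.length) :
    t ≤ succMax L i ↔ i < L.countP (fun x => decide (t ≤ x)) := by
  have hperm := List.perm_insertionSort (· ≥ ·) L
  have hlen : (L.insertionSort (· ≥ ·)).length = L.length := List.length_insertionSort _ _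
  have hi' : i < (L.insertionSort (· ≥ ·)).length := by rwa [hlen]
  unfold succMax
  rw [List.getD_eq_getElem _ _ hi', ← hperm.countP_eq,
    lt_countP_iff_of_sortedGE (List.sortedGE_insertionSort (l := L)) t hi']

/-- Pointwise `≤` lists have `≤` counts of entries above any threshold. [folklore] -/
private theorem countP_le_of_forall₂ {L' L : List ℤ} (h : List.Forall₂ (· ≤ ·) L' L) (t : ℤ) :
    L'.countP (fun x => decide (t ≤ x)) ≤ L.countP (fun x => decide (t ≤ x)) := by
  induction h with
  | nil => simp
  | @cons a b _ _ hab _ ih =>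
    rw [List.countP_cons, List.countP_cons]
    by_cases h1 : t ≤ a <;> by_cases h2 : t ≤ b <;> simp [h1, h2] <;> omega

/-- Pointwise `≤` lists have `≤` successive maxima. [folklore] -/
private theorem succMax_le_of_forall₂ {L' L : List ℤ} (h : List.Forall₂ (· ≤ ·) L' L) {i : ℕ} (hi : i < L'.length) :
    succMax L' i ≤ succMax L i := by
  have hlen : L'.length = L.length := h.length_eq
  have h1 := (le_succMax_iff (succMax L' i) hi).1 le_rfl
  exact (le_succMax_iff (succMax L' i) (hlen ▸ hi)).2 (lt_of_lt_of_le h1 (countP_le_of_forall₂ h _))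

/-! ### `d_n` and the product `d_M d_N d_Q` -/

/-- `d_u ∣ d_v` for `u ≤ v`. [folklore] -/
private theorem d_dvd_d {u v : ℤ} (h : u ≤ v) : d u ∣ d v :=
  lcmUpto_dvd_lcmUpto_of_le (Int.toNat_le_toNat h)

/-- `d_M d_N d_Q` of a list (so that `denomS P = D3 P.S`). [cite: RhinViola2001, Theorem 2.1] -/
theorem denomS_eq (P : Params) : denomS P = d (succMax P.S 0) * d (succMax P.S 1) * d (succMax P.S 2) := rfl

/-- Three thresholds `t₁ ≥ t₂ ≥ t₃` exceeded by at least one, two, three entries: `d_{t₁} d_{t₂} d_{t₃} ∣ d_M d_N d_Q`.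
[cite: RhinViola2001, Theorem 2.1 (proof, "occur in distinct places in the list (2.8)")] -/
theorem prod_d_dvd_of_sorted {L : List ℤ} (hL : 3 ≤ L.length) {t₁ t₂ t₃ : ℤ}
    (h₁ : 1 ≤ L.countP (fun x => decide (t₁ ≤ x))) (h₂ : 2 ≤ L.countP (fun x => decide (t₂ ≤ x)))
    (h₃ : 3 ≤ L.countP (fun x => decide (t₃ ≤ x))) :
    d t₁ * d t₂ * d t₃ ∣ d (succMax L 0) * d (succMax L 1) * d (succMax L 2) := by
  refine mul_dvd_mul (mul_dvd_mul (d_dvd_d ?_) (d_dvd_d ?_)) (d_dvd_d ?_)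
  · exact (le_succMax_iff t₁ (by omega)).2 (by omega)
  · exact (le_succMax_iff t₂ (by omega)).2 (by omega)
  · exact (le_succMax_iff t₃ (by omega)).2 (by omega)

/-- Three values `a ≥ b ≥ c` such that, for every threshold `t`, at least as many entries of `L` are `≥ t` as among
`a, b, c`: `d_a d_b d_c ∣ d_M d_N d_Q`. [cite: RhinViola2001, Theorem 2.1 (proof)] -/
theorem prod_d_dvd_of_le {L : List ℤ} (hL : 3 ≤ L.length) {a b c : ℤ} (hcb : c ≤ b) (hba : b ≤ a)
    (hc : ∀ t : ℤ, (if t ≤ a then 1 else 0) + (if t ≤ b then 1 else 0) + (if t ≤ c then 1 else 0) ≤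
      L.countP (fun x => decide (t ≤ x))) :
    d a * d b * d c ∣ d (succMax L 0) * d (succMax L 1) * d (succMax L 2) := by
  apply prod_d_dvd_of_sorted hL
  · have := hc a; split_ifs at this <;> omega
  · have := hc b; split_ifs at this <;> omega
  · have := hc c; split_ifs at this <;> omega

/-- Three values `u, v, w` such that, for every threshold `t`, at least as many entries of `L` are `≥ t` as among
`u, v, w` (e.g. three entries at distinct places of `L`): `d_u d_v d_w ∣ d_M d_N d_Q`.
[cite: RhinViola2001, Theorem 2.1 (proof, "occur in distinct places in the list (2.8)")] -/
theorem prod_d_dvd {L : List ℤ} (hL : 3 ≤ L.length) {u v w : ℤ}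
    (hc : ∀ t : ℤ, (if t ≤ u then 1 else 0) + (if t ≤ v then 1 else 0) + (if t ≤ w then 1 else 0) ≤
      L.countP (fun x => decide (t ≤ x))) :
    d u * d v * d w ∣ d (succMax L 0) * d (succMax L 1) * d (succMax L 2) := by
  rcases le_total u v with h1 | h1 <;> rcases le_total v w with h2 | h2 <;> rcases le_total u w with h3 | h3
  all_goals first
    | exact prod_d_dvd_of_le hL (a := u) (b := v) (c := w) (by omega) (by omega)
        (fun t => by have := hc t; split_ifs at this ⊢ <;> omega)
    | simpa only [mul_comm, mul_left_comm, mul_assoc] using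
        prod_d_dvd_of_le hL (a := u) (b := w) (c := v) (by omega) (by omega)
          (fun t => by have := hc t; split_ifs at this ⊢ <;> omega)
    | simpa only [mul_comm, mul_left_comm, mul_assoc] using
        prod_d_dvd_of_le hL (a := v) (b := u) (c := w) (by omega) (by omega)
          (fun t => by have := hc t; split_ifs at this ⊢ <;> omega)
    | simpa only [mul_comm, mul_left_comm, mul_assoc] using
        prod_d_dvd_of_le hL (a := v) (b := w) (c := u) (by omega) (by omega)
          (fun t => by have := hc t; split_ifs at this ⊢ <;> omega)
    | simpa only [mul_comm, mul_left_comm, mul_assoc] using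
        prod_d_dvd_of_le hL (a := w) (b := u) (c := v) (by omega) (by omega)
          (fun t => by have := hc t; split_ifs at this ⊢ <;> omega)
    | simpa only [mul_comm, mul_left_comm, mul_assoc] using
        prod_d_dvd_of_le hL (a := w) (b := v) (c := u) (by omega) (by omega)
          (fun t => by have := hc t; split_ifs at this ⊢ <;> omega)

/-- Pointwise `≤` lists (of length `≥ 3`) have `d_{M'} d_{N'} d_{Q'} ∣ d_M d_N d_Q`.
[cite: RhinViola2001, Theorem 2.1 (proof, "do not exceed, respectively, the integers M, N and Q for I")] -/
theorem prod_d_succMax_dvd_of_forall₂ {L' L : List ℤ} (h : List.Forall₂ (· ≤ ·) L' L) (hL : 3 ≤ L'.length) :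
    d (succMax L' 0) * d (succMax L' 1) * d (succMax L' 2) ∣ d (succMax L 0) * d (succMax L 1) * d (succMax L 2) :=
  mul_dvd_mul (mul_dvd_mul (d_dvd_d (succMax_le_of_forall₂ h (by omega)))
    (d_dvd_d (succMax_le_of_forall₂ h (by omega)))) (d_dvd_d (succMax_le_of_forall₂ h (by omega)))

/-! ### The list of parameters, its sum, and the powers of `ϑ` -/

/-- `Params.toList` spelled out. [cite: RhinViola2001, §2 (2.7)] -/
theorem toList_eq (P : Params) : P.toList = [P.h, P.j, P.k, P.l, P.m, P.q, P.r, P.s] := rfl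

/-- The sum `h + j + k + l + m + q + r + s`. [cite: RhinViola2001, §2 (2.7)] -/
theorem toList_sum (P : Params) : P.toList.sum = P.h + P.j + P.k + P.l + P.m + P.q + P.r + P.s := by
  simp [toList_eq]; ring

/-- "the sum of the integers (2.8)" equals `h + j + ⋯ + s`. [cite: RhinViola2001, Theorem 2.1 (proof)] -/
theorem aux_toList_sum (P : Params) : P.aux.toList.sum = P.toList.sum := by
  rw [toList_sum, toList_sum]; simp only [Params.aux]; ring

/-- `ϑ²` on the parameters. [cite: RhinViola2001, §2 p. 272] -/
theorem theta_iter_two (P : Params) : theta^[2] P = ⟨P.k, P.l, P.m, P.q, P.r, P.s, P.h, P.j⟩ := rfl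
/-- `ϑ³` on the parameters. [cite: RhinViola2001, §2 p. 272] -/
theorem theta_iter_three (P : Params) : theta^[3] P = ⟨P.l, P.m, P.q, P.r, P.s, P.h, P.j, P.k⟩ := rfl
/-- `ϑ⁴` on the parameters. [cite: RhinViola2001, §2 p. 272] -/
theorem theta_iter_four (P : Params) : theta^[4] P = ⟨P.m, P.q, P.r, P.s, P.h, P.j, P.k, P.l⟩ := rfl
/-- `ϑ⁵` on the parameters. [cite: RhinViola2001, §2 p. 272] -/
theorem theta_iter_five (P : Params) : theta^[5] P = ⟨P.q, P.r, P.s, P.h, P.j, P.k, P.l, P.m⟩ := rfl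
/-- `ϑ⁶` on the parameters. [cite: RhinViola2001, §2 p. 272] -/
theorem theta_iter_six (P : Params) : theta^[6] P = ⟨P.r, P.s, P.h, P.j, P.k, P.l, P.m, P.q⟩ := rfl
/-- `ϑ⁷` on the parameters. [cite: RhinViola2001, §2 p. 272] -/
theorem theta_iter_seven (P : Params) : theta^[7] P = ⟨P.s, P.h, P.j, P.k, P.l, P.m, P.q, P.r⟩ := rfl
/-- `ϑ⁸ = 1` on the parameters. [cite: RhinViola2001, §2 (2.4)] -/
theorem theta_iter_eight (P : Params) : theta^[8] P = P := rfl

/-- `ϑ^{8k} = 1` on the parameters. [cite: RhinViola2001, §2 (2.4)] -/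
theorem theta_iter_eight_mul (k : ℕ) (P : Params) : theta^[8 * k] P = P := by
  induction k with
  | zero => rfl
  | succ k ih => rw [Nat.mul_succ, Function.iterate_add_apply, theta_iter_eight, ih]

/-- `ϑⁿ` only depends on `n mod 8`. [cite: RhinViola2001, §2 (2.4)] -/
theorem theta_iter_mod (n : ℕ) (P : Params) : theta^[n] P = theta^[n % 8] P := by
  conv_lhs => rw [← Nat.mod_add_div n 8, Function.iterate_add_apply, theta_iter_eight_mul]

/-- Powers of `ϑ` preserve (2.2)–(2.3). [cite: RhinViola2001, §2 p. 273] -/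
theorem balanced_theta_iter {P : Params} (hB : P.Balanced) (n : ℕ) : (theta^[n] P).Balanced := by
  induction n with
  | zero => exact hB
  | succ n ih => rw [Function.iterate_succ_apply']; exact balanced_theta ih

/-- Powers of `ϑ` preserve non-negativity. [cite: RhinViola2001, §2 p. 272] -/
theorem nonneg_theta_iter {P : Params} (hN : P.Nonneg) (n : ℕ) : (theta^[n] P).Nonneg := by
  induction n with
  | zero => exact hN
  | succ n ih => rw [Function.iterate_succ_apply']; exact nonneg_theta ih

/-- Powers of `ϑ` act on the integers (2.8) by the same powers. [cite: RhinViola2001, §2 p. 273] -/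
theorem aux_theta_iter (P : Params) (n : ℕ) : (theta^[n] P).aux = theta^[n] P.aux := by
  induction n with
  | zero => rfl
  | succ n ih => rw [Function.iterate_succ_apply', Function.iterate_succ_apply', aux_theta, ih]

/-- Powers of `ϑ` preserve the sum `h + ⋯ + s`. [cite: RhinViola2001, §2 p. 272] -/
theorem toList_sum_theta_iter (P : Params) (n : ℕ) : (theta^[n] P).toList.sum = P.toList.sum := by
  induction n with
  | zero => rfl
  | succ n ih => rw [Function.iterate_succ_apply', ← ih, toList_sum, toList_sum]; simp only [theta]; ring

/-- **`Θ`-invariance, powers of `ϑ`**: `I(ϑⁿP) = I(P)` for balanced `P` (from the tree's `ThetaInvariance.I_theta`).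
[cite: RhinViola2001, §2 p. 272] -/
theorem I_theta_iter {P : Params} (hB : P.Balanced) (n : ℕ) : I (theta^[n] P) = I P := by
  induction n with
  | zero => rfl
  | succ n ih => rw [Function.iterate_succ_apply', ThetaInvariance.I_theta _ (balanced_theta_iter hB n), ih]

/-- `ϑ` permutes the list (2.8). [cite: RhinViola2001, §2 p. 273 ("ϑ and σ permute the integers (2.8)")] -/
theorem S_perm_theta (P : Params) : (theta P).S.Perm P.S := by
  rw [Params.S, Params.S, aux_theta]
  show [P.aux.j, P.aux.k, P.aux.l, P.aux.m, P.aux.q, P.aux.r, P.aux.s, P.aux.h].Perm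
    [P.aux.h, P.aux.j, P.aux.k, P.aux.l, P.aux.m, P.aux.q, P.aux.r, P.aux.s]
  exact (List.perm_append_comm (l₁ := [P.aux.j, P.aux.k, P.aux.l, P.aux.m, P.aux.q, P.aux.r, P.aux.s])
    (l₂ := [P.aux.h]))

/-- "`M`, `N` and `Q` are invariant under the action of `ϑ`": `d_M d_N d_Q` is. [cite: RhinViola2001, Theorem 2.1 (proof)] -/
theorem denomS_theta (P : Params) : denomS (theta P) = denomS P := by
  simp only [denomS, succMax_eq_of_perm (S_perm_theta P)]

/-- `d_M d_N d_Q` is invariant under powers of `ϑ`. [cite: RhinViola2001, Theorem 2.1 (proof)] -/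
theorem denomS_theta_iter (P : Params) (n : ℕ) : denomS (theta^[n] P) = denomS P := by
  induction n with
  | zero => rfl
  | succ n ih => rw [Function.iterate_succ_apply', denomS_theta, ih]

/-! ### The slots of (2.8) used in the proof -/

/-- The list (2.8) spelled out. [cite: RhinViola2001, §2 (2.8)] -/
theorem S_eq (P : Params) :
    P.S = [P.aux.h, P.aux.j, P.aux.k, P.aux.l, P.aux.m, P.aux.q, P.aux.r, P.aux.s] := rfl

/-- "Since `r+l−q`, `m+s−q` and `j+r−h` occur in distinct places in the list (2.8), we get `d_M d_N d_Q I ∈ ℤ`":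
`d_{r'} d_{m'} d_{j'} ∣ d_M d_N d_Q`. [cite: RhinViola2001, Theorem 2.1 (proof, p. 274)] -/
theorem d_slots_dvd_denomS (P : Params) : d P.aux.r * d P.aux.m * d P.aux.j ∣ denomS P := by
  rw [denomS_eq]
  refine prod_d_dvd (by simp [S_eq]) fun t => ?_
  simp only [S_eq, List.countP_cons, List.countP_nil, decide_eq_true_eq]
  split_ifs <;> omega

/-- For the terminal tuple `(t,0,t,0,t,0,t,0)`: "four of the integers (2.8) are equal to `h` and the other four vanish",
so `d_t³ ∣ d_M d_N d_Q`. [cite: RhinViola2001, Theorem 2.1 (proof, (2.11))] -/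
theorem d_cube_dvd_denomS_star (t : ℤ) : d t * d t * d t ∣ denomS ⟨t, 0, t, 0, t, 0, t, 0⟩ := by
  rw [denomS_eq]
  refine prod_d_dvd (by simp [S_eq]) fun u => ?_
  simp only [S_eq, Params.aux, List.countP_cons, List.countP_nil, decide_eq_true_eq, add_zero, sub_zero,
    zero_add, sub_self]
  split_ifs <;> omega

/-! ### The three tuples of the linear decomposition (2.10) -/

/-- (2.10), first tuple `(h,j,k,l−1,m−1,q−1,r−1,s)`: balanced, non-negative when `lmqr > 0`, smaller sum, and
`d_{M₁} d_{N₁} d_{Q₁} ∣ d_M d_N d_Q` ("at least two of the integers (2.8) are less … and none is greater").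
[cite: RhinViola2001, Theorem 2.1 (proof, (2.10))] -/
theorem decomp_one {P : Params} (hN : P.Nonneg) (hB : P.Balanced)
    (hw : 0 < P.l ∧ 0 < P.m ∧ 0 < P.q ∧ 0 < P.r) :
    (⟨P.h, P.j, P.k, P.l - 1, P.m - 1, P.q - 1, P.r - 1, P.s⟩ : Params).Nonneg ∧
    (⟨P.h, P.j, P.k, P.l - 1, P.m - 1, P.q - 1, P.r - 1, P.s⟩ : Params).Balanced ∧
    (⟨P.h, P.j, P.k, P.l - 1, P.m - 1, P.q - 1, P.r - 1, P.s⟩ : Params).toList.sum + 4 = P.toList.sum ∧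
    denomS ⟨P.h, P.j, P.k, P.l - 1, P.m - 1, P.q - 1, P.r - 1, P.s⟩ ∣ denomS P := by
  obtain ⟨_, _, _, _, _, _, _, _⟩ := hN
  obtain ⟨_, _⟩ := hB
  refine ⟨by simp only [Params.Nonneg]; omega, by simp only [Params.Balanced]; omega,
    by rw [toList_sum, toList_sum]; ring, ?_⟩
  rw [denomS_eq, denomS_eq]
  refine prod_d_succMax_dvd_of_forall₂ ?_ (by simp [S_eq])
  simp only [S_eq, Params.aux, List.forall₂_cons, List.Forall₂.nil, and_true]
  omega

/-- (2.10), second tuple `(h+1,j,k,l−1,m−1,q−1,r,s)`. [cite: RhinViola2001, Theorem 2.1 (proof, (2.10))] -/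
theorem decomp_two {P : Params} (hN : P.Nonneg) (hB : P.Balanced)
    (hw : 0 < P.l ∧ 0 < P.m ∧ 0 < P.q ∧ 0 < P.r) :
    (⟨P.h + 1, P.j, P.k, P.l - 1, P.m - 1, P.q - 1, P.r, P.s⟩ : Params).Nonneg ∧
    (⟨P.h + 1, P.j, P.k, P.l - 1, P.m - 1, P.q - 1, P.r, P.s⟩ : Params).Balanced ∧
    (⟨P.h + 1, P.j, P.k, P.l - 1, P.m - 1, P.q - 1, P.r, P.s⟩ : Params).toList.sum + 2 = P.toList.sum ∧
    denomS ⟨P.h + 1, P.j, P.k, P.l - 1, P.m - 1, P.q - 1, P.r, P.s⟩ ∣ denomS P := by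
  obtain ⟨_, _, _, _, _, _, _, _⟩ := hN
  obtain ⟨_, _⟩ := hB
  refine ⟨by simp only [Params.Nonneg]; omega, by simp only [Params.Balanced]; omega,
    by rw [toList_sum, toList_sum]; ring, ?_⟩
  rw [denomS_eq, denomS_eq]
  refine prod_d_succMax_dvd_of_forall₂ ?_ (by simp [S_eq])
  simp only [S_eq, Params.aux, List.forall₂_cons, List.Forall₂.nil, and_true]
  omega

/-- (2.10), third tuple `(h,j+1,k,l,m−1,q−1,r−1,s)`. [cite: RhinViola2001, Theorem 2.1 (proof, (2.10))] -/
theorem decomp_three {P : Params} (hN : P.Nonneg) (hB : P.Balanced)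
    (hw : 0 < P.l ∧ 0 < P.m ∧ 0 < P.q ∧ 0 < P.r) :
    (⟨P.h, P.j + 1, P.k, P.l, P.m - 1, P.q - 1, P.r - 1, P.s⟩ : Params).Nonneg ∧
    (⟨P.h, P.j + 1, P.k, P.l, P.m - 1, P.q - 1, P.r - 1, P.s⟩ : Params).Balanced ∧
    (⟨P.h, P.j + 1, P.k, P.l, P.m - 1, P.q - 1, P.r - 1, P.s⟩ : Params).toList.sum + 2 = P.toList.sum ∧
    denomS ⟨P.h, P.j + 1, P.k, P.l, P.m - 1, P.q - 1, P.r - 1, P.s⟩ ∣ denomS P := by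
  obtain ⟨_, _, _, _, _, _, _, _⟩ := hN
  obtain ⟨_, _⟩ := hB
  refine ⟨by simp only [Params.Nonneg]; omega, by simp only [Params.Balanced]; omega,
    by rw [toList_sum, toList_sum]; ring, ?_⟩
  rw [denomS_eq, denomS_eq]
  refine prod_d_succMax_dvd_of_forall₂ ?_ (by simp [S_eq])
  simp only [S_eq, Params.aux, List.forall₂_cons, List.Forall₂.nil, and_true]
  omega

/-! ### Choosing the power of `ϑ` -/

/-- "If … the least of the integers (2.8) is `< 0`, then `I` is changed by a suitable power of the permutation `ϑ`
into an integral of the preceding type" (a negative integer in the slot `q' = q+h−r`).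
[cite: RhinViola2001, Theorem 2.1 (proof, p. 274)] -/
theorem exists_theta_iter_aux_q_neg {P : Params} (hA : ¬ P.aux.Nonneg) : ∃ i : ℕ, (theta^[i] P).aux.q < 0 := by
  simp only [Params.Nonneg, not_and_or, not_le] at hA
  rcases hA with h | h | h | h | h | h | h | h
  · exact ⟨3, by rw [aux_theta_iter, theta_iter_three]; exact h⟩
  · exact ⟨4, by rw [aux_theta_iter, theta_iter_four]; exact h⟩
  · exact ⟨5, by rw [aux_theta_iter, theta_iter_five]; exact h⟩
  · exact ⟨6, by rw [aux_theta_iter, theta_iter_six]; exact h⟩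
  · exact ⟨7, by rw [aux_theta_iter, theta_iter_seven]; exact h⟩
  · exact ⟨0, h⟩
  · exact ⟨1, by rw [aux_theta_iter, Function.iterate_one]; exact h⟩
  · exact ⟨2, by rw [aux_theta_iter, theta_iter_two]; exact h⟩

/-! ### The terminal tuples -/

/-- The terminal case with `j = 0` (both printed sub-cases "`j = q = 0`" and "`j = 0, q > 0`"): if all the integers
(2.7)–(2.8) are non-negative and no power of `ϑ` makes `lmqr > 0`, then `h = k = m = r` and `j = l = q = s = 0`.
[cite: RhinViola2001, Theorem 2.1 (proof, p. 275, "First case" and "Second case")] -/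
theorem terminal_of_j_eq_zero {P : Params} (hN : P.Nonneg) (hB : P.Balanced) (hA : P.aux.Nonneg) (hj : P.j = 0)
    (hW : ∀ i < 8, ¬ (0 < (theta^[i] P).l ∧ 0 < (theta^[i] P).m ∧ 0 < (theta^[i] P).q ∧ 0 < (theta^[i] P).r)) :
    P = ⟨P.h, 0, P.h, 0, P.h, 0, P.h, 0⟩ := by
  have W0 := hW 0 (by norm_num)
  have W1 := hW 1 (by norm_num)
  have W2 := hW 2 (by norm_num)
  have W7 := hW 7 (by norm_num)
  simp only [Function.iterate_zero, id, Function.iterate_one, theta_iter_two, theta_iter_seven, theta] at W0 W1 W2 W7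
  obtain ⟨h, j, k, l, m, q, r, s⟩ := P
  simp only [Params.Nonneg, Params.Balanced, Params.aux] at hN hB hA hj W0 W1 W2 W7 ⊢
  subst hj
  simp only [Params.mk.injEq, true_and]
  rcases (show q = 0 ∨ 0 < q by omega) with hq | hq
  · omega
  · exfalso
    by_cases hr : r = 0
    · by_cases hk : k = 0
      · omega
      · by_cases hm : m = 0
        · omega
        · exact W7 ⟨by omega, by omega, by omega, by omega⟩
    · by_cases hm : m = 0
      · by_cases hs : s = 0
        · omega
        · exact W2 ⟨by omega, by omega, by omega, by omega⟩
      · by_cases hl : l = 0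
        · by_cases hs : s = 0
          · omega
          · exact W1 ⟨by omega, by omega, by omega, by omega⟩
        · exact W0 ⟨by omega, by omega, by omega, by omega⟩

/-- **The terminal tuples.** If the integers (2.7)–(2.8) are non-negative and `lmqr = mqrs = qrsh = rshj = shjk = hjkl =
jklm = klmq = 0`, then up to a power of `ϑ` the tuple is `(h,0,h,0,h,0,h,0)` (the case of (2.11)).
[cite: RhinViola2001, Theorem 2.1 (proof, p. 275)] -/
theorem terminal {P : Params} (hN : P.Nonneg) (hB : P.Balanced) (hA : P.aux.Nonneg)
    (hW : ∀ i < 8, ¬ (0 < (theta^[i] P).l ∧ 0 < (theta^[i] P).m ∧ 0 < (theta^[i] P).q ∧ 0 < (theta^[i] P).r)) :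
    ∃ t : ℤ, 0 ≤ t ∧ ∃ n : ℕ, theta^[n] P = ⟨t, 0, t, 0, t, 0, t, 0⟩ := by
  have hzero : ∃ n : ℕ, (theta^[n] P).j = 0 := by
    by_contra hcon
    push Not at hcon
    have hl := hcon 2
    have hm := hcon 3
    have hq := hcon 4
    have hr := hcon 5
    simp only [theta_iter_two, theta_iter_three, theta_iter_four, theta_iter_five] at hl hm hq hr
    obtain ⟨_, _, _, _, _, _, _, _⟩ := hN
    exact hW 0 (by norm_num) (by simp only [Function.iterate_zero, id]; omega)
  obtain ⟨n, hn⟩ := hzero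
  have hW' : ∀ i < 8, ¬ (0 < (theta^[i] (theta^[n] P)).l ∧ 0 < (theta^[i] (theta^[n] P)).m ∧
      0 < (theta^[i] (theta^[n] P)).q ∧ 0 < (theta^[i] (theta^[n] P)).r) := by
    intro i _
    rw [← Function.iterate_add_apply, theta_iter_mod]
    exact hW _ (Nat.mod_lt _ (by norm_num))
  have hA' : (theta^[n] P).aux.Nonneg := by rw [aux_theta_iter]; exact nonneg_theta_iter hA n
  exact ⟨(theta^[n] P).h, (nonneg_theta_iter hN n).1, n,
    terminal_of_j_eq_zero (nonneg_theta_iter hN n) (balanced_theta_iter hB n) hA' hn hW'⟩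

/-- The integers (2.8) of the terminal tuple: "four of the integers (2.8) are equal to `h` and the other four vanish".
[cite: RhinViola2001, Theorem 2.1 (proof, after (2.11))] -/
theorem aux_star (t : ℤ) : (⟨t, 0, t, 0, t, 0, t, 0⟩ : Params).aux = ⟨t, 0, t, 0, t, 0, t, 0⟩ := by
  ext <;> simp [Params.aux]

/-! ### The conclusion of Theorem 2.1: transport lemmas -/

open Literature.NumberTheory.Transcendental (zetaValue)

/-- Transport of the conclusion (2.9) along equal integrals and equal `d_M d_N d_Q` (used for powers of `ϑ`).
[cite: RhinViola2001, Theorem 2.1 (proof, "M, N and Q are invariant under the actions of ϑ and σ")] -/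
theorem concl_of_eq {P Q : Params} (hI : I P = I Q) (hD : denomS P = denomS Q)
    (h : ∃ (a : ℚ) (b : ℤ), I Q = a + 2 * b * zetaValue 3 ∧ ∃ A : ℤ, (denomS Q : ℚ) * a = A) :
    ∃ (a : ℚ) (b : ℤ), I P = a + 2 * b * zetaValue 3 ∧ ∃ A : ℤ, (denomS P : ℚ) * a = A := by
  rw [hI, hD]; exact h

/-- "Thus if Theorem 2.1 holds for the three integrals, it also holds for `I`" (the step (2.10)).
[cite: RhinViola2001, Theorem 2.1 (proof, pp. 274–275)] -/
theorem concl_of_decomp {P P₁ P₂ P₃ : Params} (hI : I P = I P₁ - I P₂ - I P₃)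
    (h₁ : denomS P₁ ∣ denomS P) (h₂ : denomS P₂ ∣ denomS P) (h₃ : denomS P₃ ∣ denomS P)
    (c₁ : ∃ (a : ℚ) (b : ℤ), I P₁ = a + 2 * b * zetaValue 3 ∧ ∃ A : ℤ, (denomS P₁ : ℚ) * a = A)
    (c₂ : ∃ (a : ℚ) (b : ℤ), I P₂ = a + 2 * b * zetaValue 3 ∧ ∃ A : ℤ, (denomS P₂ : ℚ) * a = A)
    (c₃ : ∃ (a : ℚ) (b : ℤ), I P₃ = a + 2 * b * zetaValue 3 ∧ ∃ A : ℤ, (denomS P₃ : ℚ) * a = A) :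
    ∃ (a : ℚ) (b : ℤ), I P = a + 2 * b * zetaValue 3 ∧ ∃ A : ℤ, (denomS P : ℚ) * a = A := by
  obtain ⟨a₁, b₁, e₁, A₁, hA₁⟩ := c₁
  obtain ⟨a₂, b₂, e₂, A₂, hA₂⟩ := c₂
  obtain ⟨a₃, b₃, e₃, A₃, hA₃⟩ := c₃
  obtain ⟨k₁, hk₁⟩ := h₁
  obtain ⟨k₂, hk₂⟩ := h₂
  obtain ⟨k₃, hk₃⟩ := h₃
  refine ⟨a₁ - a₂ - a₃, b₁ - b₂ - b₃, ?_, A₁ * k₁ - A₂ * k₂ - A₃ * k₃, ?_⟩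
  · rw [hI, e₁, e₂, e₃]; push_cast; ring
  · have g₁ : (denomS P : ℚ) * a₁ = A₁ * k₁ := by rw [hk₁, ← hA₁]; push_cast; ring
    have g₂ : (denomS P : ℚ) * a₂ = A₂ * k₂ := by rw [hk₂, ← hA₂]; push_cast; ring
    have g₃ : (denomS P : ℚ) * a₃ = A₃ * k₃ := by rw [hk₃, ← hA₃]; push_cast; ring
    rw [mul_sub, mul_sub, g₁, g₂, g₃]; push_cast; ring

/-- A rational integral with a controlled denominator satisfies (2.9) "with `b = 0`" (the polynomial case).
[cite: RhinViola2001, Theorem 2.1 (proof, p. 274)] -/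
theorem concl_of_rat {P : Params} {ρ : ℚ} {D : ℕ} (hI : I P = ρ) (hD : D ∣ denomS P)
    (hz : ∃ z : ℤ, (D : ℚ) * ρ = z) :
    ∃ (a : ℚ) (b : ℤ), I P = a + 2 * b * zetaValue 3 ∧ ∃ A : ℤ, (denomS P : ℚ) * a = A := by
  obtain ⟨z, hz⟩ := hz
  obtain ⟨k, hk⟩ := hD
  refine ⟨ρ, 0, by rw [hI]; simp, z * k, ?_⟩
  rw [hk]; push_cast; rw [← hz]; ring

/-- `(ν+1) ∣ d_t` for `ν < t`. [folklore] -/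
private theorem succ_dvd_lcmUpto {t ν : ℕ} (hν : ν < t) : ν + 1 ∣ Nat.lcmUpto t := by
  rw [Nat.lcmUpto]; exact Finset.dvd_lcm (Finset.mem_Icc.2 ⟨by omega, by omega⟩)

/-- The terminal value (2.11) `I = −2Σ_{ν=1}^{t} ν^{−3} + 2ζ(3)` with `d_t³ ∣ d_M d_N d_Q` gives (2.9) with `b = 1`
("for this integral, (2.9) holds with `d_{3h} a ∈ ℤ`" — read `d_h³ a ∈ ℤ`).
[cite: RhinViola2001, Theorem 2.1 (proof, (2.11))] -/
theorem concl_of_star {P : Params} {t : ℕ}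
    (hI : I P = 2 * zetaValue 3 - 2 * ∑ ν ∈ Finset.range t, 1 / ((ν : ℝ) + 1) ^ 3)
    (hD : d t * d t * d t ∣ denomS P) :
    ∃ (a : ℚ) (b : ℤ), I P = a + 2 * b * zetaValue 3 ∧ ∃ A : ℤ, (denomS P : ℚ) * a = A := by
  obtain ⟨k, hk⟩ := hD
  refine ⟨-2 * ∑ ν ∈ Finset.range t, 1 / ((ν : ℚ) + 1) ^ 3, 1, ?_,
    -2 * k * ∑ ν ∈ Finset.range t, ((Nat.lcmUpto t / (ν + 1) : ℕ) : ℤ) ^ 3, ?_⟩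
  · rw [hI]; push_cast; ring
  · have hd : d t = Nat.lcmUpto t := by simp [d]
    rw [hk, hd]
    simp only [Nat.cast_mul, Int.cast_mul, Int.cast_neg, Int.cast_ofNat, Int.cast_natCast, Int.cast_sum,
      Int.cast_pow, Finset.mul_sum]
    refine Finset.sum_congr rfl fun ν hν => ?_
    have hc : ((Nat.lcmUpto t / (ν + 1) : ℕ) : ℚ) * ((ν : ℚ) + 1) = Nat.lcmUpto t := by
      exact_mod_cast Nat.div_mul_cancel (succ_dvd_lcmUpto (Finset.mem_range.1 hν))
    have hν0 : ((ν : ℚ) + 1) ≠ 0 := by positivity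
    rw [← hc]; field_simp

end TheoremTwoOne

end Literature.NumberTheory.Irrationality.RhinViola2001

end
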